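import Literature.NumberTheory.LFunctions.MontgomeryExplicitFormulaLineIntegral
import Literature.NumberTheory.LFunctions.WeilExplicitFormulaProofs
import Literature.NumberTheory.LFunctions.ZetaLogDerivRH
import Literature.NumberTheory.LFunctions.ZetaZeroBoxEnumeration
import Literature.NumberTheory.LFunctions.MontgomeryPairCorrelationProofs
import Literature.NumberTheory.LFunctions.ZetaZerosProofs
import HarnessLib

/-!
# Montgomery's explicit formula: the contour argument

Trunk T-ANT (`Literature/NumberTheory/LFunctions`), fifth support file for the discharge of the
named fact (P1) `Literature.NumberTheory.LFunctions.montgomery_explicit_formula` (Montgomery 1973,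
Lemma; Goldston 2005, Proposition 1 (3.11)). Proofs only.

Goldston derives (3.11) from Landau's explicit formula for `∑_{n ≤ x} Λ(n) n^{−s}` at the two
points `s = −1/2 + it`, `3/2 + it`. Here the same identity is obtained directly by the residue
theorem, organised as in the tree's proof of the Guinand–Weil explicit formula
(`WeilExplicitFormulaProofs.lean`, after Bombieri): the weighted argument principle
(`Literature.Analysis.Complex.integral_boundary_rect_logDeriv_mul`) for `ξ` and the weight
`r(s) = x^s (1/(s−s₁) − 1/(s−s₂))`, `s₁ = −1/2+it`, `s₂ = 3/2+it` (analytic on the closed rectangle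
`[−1/4, 5/4] × [−T, T]`, its poles lying on `re s = −1/2` and `re s = 3/2`), with the left edge
folded onto the right one by `ξ'/ξ(1−s) = −ξ'/ξ(s)`:

* `Montgomery.zeroSidePartial_eq_contour` — at a height `T` avoided by the ordinates,
  `2πi Σ_{|Im ρ| ≤ T} m(ρ) r(ρ) = (bottom) − (top) + i ∫_{−T}^{T} (ξ'/ξ)(5/4+iy)[r(s) + r(1−s)] dy`;
* `Montgomery.zeroSidePartial_eq_sum_range` — under RH, `ρ = 1/2 + iγ` and
  `r(1/2+iγ) + r(1/2−iγ) = 2x^{1/2}(x^{iγ}/(1+(t−γ)²) + x^{−iγ}/(1+(t+γ)²))`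
  (`Montgomery.weight_half_add_weight_half_neg`), so the truncated zero side is
  `2x^{1/2} Σ_{n < N(T)} montgomeryZeroSummand x t n` (enumeration by `zetaOrdinate`,
  `finsum_zetaZeroBox_mul_eq_sum_range`);
* `Montgomery.norm_horizontal_le`, `Montgomery.horizontal_bound_aux` — at the good heights of
  `ZetaLogDerivRH.exists_goodHeight` (distance `≫ 1/log T` from all ordinates; under RH every zero
  of positive real part qualifies) the horizontal sides are `≪ x^{5/4} log²T/T → 0`
  (`exists_norm_logDeriv_riemannXi_le` and `|r(σ ± iT)| ≤ 2x^{5/4}/(T−|t|)`);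
* `Montgomery.two_pi_mul_zeroSum_eq_lineIntegral` — letting `T → ∞`:
  **`2π · 2x^{1/2} S(x,t) = ∫ (ξ'/ξ)(5/4+iy)[r(s) + r(1−s)] dy`**, `S = montgomeryZeroSum x t`
  (the right-hand side is evaluated in `MontgomeryExplicitFormulaLineIntegral.lean`).

## References

* H. L. Montgomery, *The pair correlation of zeros of the zeta function*, Proc. Sympos. Pure Math.
  24 (1973), 181–193, Lemma.
* D. A. Goldston, *Notes on pair correlation of zeros and prime numbers*, LMS Lecture Note Ser. 322
  (2005), Proposition 1, (3.11)–(3.14).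
* E. Bombieri, *Remarks on Weil's quadratic functional in the theory of prime numbers I*, Rend.
  Mat. Acc. Lincei (9) 11 (2000), §2 (folding of the contour).
-/

noncomputable section

open Complex Filter Set MeasureTheory
open ArithmeticFunction hiding log id
open scoped Real Topology ComplexConjugate

namespace Literature.NumberTheory.LFunctions

namespace Montgomery

open Literature.Analysis.Complex

/-! ## The weight `r(s) = x^s k(s)` -/

/-- The weight `r(s) = x^s (1/(s−s₁) − 1/(s−s₂))` is differentiable off `s₁ = −1/2+it`,
`s₂ = 3/2+it`, in particular on the open strip `−1/2 < re s < 3/2`. [folklore] -/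
theorem differentiableOn_weight {x : ℝ} (hx : 0 < x) (t : ℝ) :
    DifferentiableOn ℂ (fun s : ℂ ↦ (x : ℂ) ^ s *
        (1 / (s - (-1 / 2 + t * I)) - 1 / (s - (3 / 2 + t * I))))
      (re ⁻¹' Ioo (-1 / 2) (3 / 2)) := by
  have hx0 : (x : ℂ) ≠ 0 := ofReal_ne_zero.2 hx.ne'
  refine DifferentiableOn.mul (fun s _ ↦ ?_) (differentiableOn_inv_sub_inv _ _ fun s hs ↦ ⟨?_, ?_⟩)
  · exact (differentiableAt_id.const_cpow (Or.inl hx0)).differentiableWithinAt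
  · intro h; rw [h] at hs; norm_num at hs
  · intro h; rw [h] at hs; norm_num at hs

/-- The weight is analytic on a neighbourhood of every point of the closed rectangle
`[−1/4, 5/4] × [−T, T]`. [folklore] -/
theorem analyticOnNhd_weight {x : ℝ} (hx : 0 < x) (t T : ℝ) :
    AnalyticOnNhd ℂ (fun s : ℂ ↦ (x : ℂ) ^ s *
        (1 / (s - (-1 / 2 + t * I)) - 1 / (s - (3 / 2 + t * I))))
      (Icc (-(1 / 4) : ℝ) (5 / 4) ×ℂ Icc (-T) T) := by
  have hopen : IsOpen (re ⁻¹' Ioo (-1 / 2 : ℝ) (3 / 2)) := isOpen_Ioo.preimage continuous_re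
  refine ((differentiableOn_weight hx t).analyticOnNhd hopen).mono ?_
  intro s hs
  obtain ⟨⟨h1, h2⟩, -⟩ := Complex.mem_reProdIm.1 hs
  simp only [mem_preimage, mem_Ioo]
  constructor <;> linarith

/-! ## The contour identity at a good height -/

/-- **The residue theorem for `(ξ'/ξ) r` on `[−1/4, 5/4] × [−T, T]`, left edge folded**
(`r(s) = x^s(1/(s−s₁) − 1/(s−s₂))`, `s₁ = −1/2+it`, `s₂ = 3/2+it`; Bombieri's organisation of
the explicit formula, as in `weilZeroSidePartial_eq_contour`): if `T > 0` is not `±` the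
ordinate of a zero then
`2πi Σ_{|Im ρ| ≤ T} m(ρ) r(ρ) = ∫_{−1/4}^{5/4} (ξ'/ξ r)(σ − iT) dσ − ∫_{−1/4}^{5/4} (ξ'/ξ r)(σ + iT) dσ
  + i ∫_{−T}^{T} (ξ'/ξ)(5/4 + iy) [r(5/4 + iy) + r(1 − (5/4+iy))] dy`.
[cite: Goldston2005, Proposition 1, (3.13)–(3.14)] -/
theorem zeroSidePartial_eq_contour {x : ℝ} (hx : 0 < x) (t : ℝ) {T : ℝ} (hT : 0 < T)
    (hgood : ∀ ρ ∈ ZetaZeros.riemannZetaNontrivialZeros, ρ.im ≠ T ∧ ρ.im ≠ -T) :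
    2 * π * I * ∑ᶠ ρ ∈ weilZeroIndex T, (riemannZetaZeroOrder ρ : ℂ) *
        ((x : ℂ) ^ ρ * (1 / (ρ - (-1 / 2 + t * I)) - 1 / (ρ - (3 / 2 + t * I)))) =
      (∫ σ : ℝ in (-(1 / 4) : ℝ)..(5 / 4), logDeriv riemannXi (σ + (-T : ℝ) * I) *
          ((x : ℂ) ^ ((σ : ℂ) + (-T : ℝ) * I) *
            (1 / ((σ : ℂ) + (-T : ℝ) * I - (-1 / 2 + t * I)) -
              1 / ((σ : ℂ) + (-T : ℝ) * I - (3 / 2 + t * I))))) -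
      (∫ σ : ℝ in (-(1 / 4) : ℝ)..(5 / 4), logDeriv riemannXi (σ + T * I) *
          ((x : ℂ) ^ ((σ : ℂ) + T * I) *
            (1 / ((σ : ℂ) + T * I - (-1 / 2 + t * I)) - 1 / ((σ : ℂ) + T * I - (3 / 2 + t * I))))) +
      I * ∫ y : ℝ in (-T)..T, logDeriv riemannXi (((5 / 4 : ℝ) : ℂ) + y * I) *
        ((x : ℂ) ^ (((5 / 4 : ℝ) : ℂ) + y * I) *
            (1 / (((5 / 4 : ℝ) : ℂ) + y * I - (-1 / 2 + t * I)) -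
              1 / (((5 / 4 : ℝ) : ℂ) + y * I - (3 / 2 + t * I))) +
          (x : ℂ) ^ (1 - ((((5 / 4 : ℝ) : ℂ)) + y * I)) *
            (1 / ((1 - ((((5 / 4 : ℝ) : ℂ)) + y * I)) - (-1 / 2 + t * I)) -
              1 / ((1 - ((((5 / 4 : ℝ) : ℂ)) + y * I)) - (3 / 2 + t * I)))) := by
  -- the weight
  obtain ⟨r, hr⟩ : ∃ r : ℂ → ℂ, r = fun s : ℂ ↦ (x : ℂ) ^ s *
      (1 / (s - (-1 / 2 + t * I)) - 1 / (s - (3 / 2 + t * I))) := ⟨_, rfl⟩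
  have er : ∀ s : ℂ, (x : ℂ) ^ s * (1 / (s - (-1 / 2 + t * I)) - 1 / (s - (3 / 2 + t * I))) = r s := by
    intro s; rw [hr]
  simp only [er]
  -- non-vanishing of `ξ` on the four edges
  have hhor : ∀ (τ : ℝ), (τ = T ∨ τ = -T) → ∀ σ : ℝ, riemannXi (σ + τ * I) ≠ 0 := by
    intro τ hτ σ h0
    have hmem := mem_riemannZetaNontrivialZeros_of_riemannXi_eq_zero h0
    have := hgood _ hmem
    simp at this
    rcases hτ with rfl | rfl
    · exact this.1 rfl
    · exact this.2 rfl
  have key := Literature.Analysis.Complex.integral_boundary_rect_logDeriv_mul (f := riemannXi) (g := r)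
    (a := -(1 / 4)) (b := 5 / 4) (c := -T) (d := T) (by norm_num) (by linarith)
    (fun z _ ↦ differentiable_riemannXi.analyticAt z) (by rw [hr]; exact analyticOnNhd_weight hx t T)
    (fun σ _ ↦ by exact_mod_cast hhor (-T) (Or.inr rfl) σ) (fun σ _ ↦ hhor T (Or.inl rfl) σ)
    (fun y _ ↦ riemannXi_ne_zero_of_re_le_zero (by norm_num))
    (fun y _ ↦ riemannXi_ne_zero_of_one_le_re (by norm_num))
  simp only [← logDeriv_apply] at key
  -- the zero sum
  have hsum : (∑ᶠ ρ ∈ {ρ : ℂ | riemannXi ρ = 0 ∧ ρ ∈ Ioo (-(1 / 4) : ℝ) (5 / 4) ×ℂ Ioo (-T) T},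
      ((meromorphicOrderAt riemannXi ρ).untop₀ : ℂ) * r ρ) =
      ∑ᶠ ρ ∈ weilZeroIndex T, (riemannZetaZeroOrder ρ : ℂ) * r ρ := by
    have hset : {ρ : ℂ | riemannXi ρ = 0 ∧ ρ ∈ Ioo (-(1 / 4) : ℝ) (5 / 4) ×ℂ Ioo (-T) T} =
        weilZeroIndex T := by
      ext ρ
      simp only [mem_setOf_eq, Complex.mem_reProdIm, mem_Ioo, weilZeroIndex]
      constructor
      · rintro ⟨h0, -, hi1, hi2⟩
        obtain ⟨hζ, hre0, hre1, him⟩ := riemannXi_zero_prop h0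
        exact ⟨hζ, hre0.le, hre1.le, him, abs_le.2 ⟨hi1.le, hi2.le⟩⟩
      · intro h
        have hmem : ρ ∈ ZetaZeros.riemannZetaNontrivialZeros :=
          ZetaZeros.riemannZetaNontrivialZeros.mem_of_im_ne_zero h.1 h.2.2.2.1
        have habs : |ρ.im| ≤ T := h.2.2.2.2
        obtain ⟨hne1, hne2⟩ := hgood ρ hmem
        refine ⟨riemannXi_eq_zero_of_mem_riemannZetaNontrivialZeros hmem, ⟨?_, ?_⟩, ?_, ?_⟩
        · linarith [ZetaZeros.riemannZetaNontrivialZeros.re_pos hmem]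
        · linarith [ZetaZeros.riemannZetaNontrivialZeros.re_lt_one hmem]
        · exact lt_of_le_of_ne (abs_le.1 habs).1 (Ne.symm hne2)
        · exact lt_of_le_of_ne (abs_le.1 habs).2 hne1
    rw [hset]
    refine finsum_mem_congr rfl fun ρ hρ ↦ ?_
    have hmem : ρ ∈ ZetaZeros.riemannZetaNontrivialZeros := by
      rw [weilZeroIndex_eq_inter] at hρ; exact hρ.1
    rw [untop₀_meromorphicOrderAt_riemannXi (ZetaZeros.riemannZetaNontrivialZeros.re_pos hmem)
      (ZetaZeros.riemannZetaNontrivialZeros.ne_one hmem)]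
  rw [hsum] at key
  rw [← key]
  -- fold the left edge
  have hleft : (∫ y : ℝ in (-T)..T, logDeriv riemannXi (((-(1 / 4) : ℝ) : ℂ) + y * I) *
      r (((-(1 / 4) : ℝ) : ℂ) + y * I)) =
      -∫ y : ℝ in (-T)..T, logDeriv riemannXi (((5 / 4 : ℝ) : ℂ) + y * I) *
        r (1 - (((5 / 4 : ℝ) : ℂ) + y * I)) := by
    have e : ∀ y : ℝ, (((-(1 / 4) : ℝ) : ℂ) + y * I) = 1 - ((((5 / 4 : ℝ) : ℂ) + ((-y : ℝ) : ℂ) * I)) := by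
      intro y; push_cast; ring
    have h1 : (fun y : ℝ ↦ logDeriv riemannXi (((-(1 / 4) : ℝ) : ℂ) + y * I) *
        r (((-(1 / 4) : ℝ) : ℂ) + y * I)) = fun y : ℝ ↦
        -((fun u : ℝ ↦ logDeriv riemannXi (((5 / 4 : ℝ) : ℂ) + u * I) *
          r (1 - (((5 / 4 : ℝ) : ℂ) + u * I))) (-y)) := by
      funext y
      simp only
      rw [e y, logDeriv_riemannXi_one_sub]
      push_cast
      ring
    rw [h1, intervalIntegral.integral_neg, intervalIntegral.integral_comp_neg (fun u : ℝ ↦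
      logDeriv riemannXi (((5 / 4 : ℝ) : ℂ) + u * I) * r (1 - (((5 / 4 : ℝ) : ℂ) + u * I)))]
    simp
  rw [hleft]
  -- combine the two vertical pieces
  have hξ : ∀ y : ℝ, riemannXi (((5 / 4 : ℝ) : ℂ) + y * I) ≠ 0 := fun y ↦
    riemannXi_ne_zero_of_one_le_re (by simp; norm_num)
  have hc1 : Continuous fun y : ℝ ↦ logDeriv riemannXi (((5 / 4 : ℝ) : ℂ) + y * I) :=
    continuous_logDeriv_riemannXi_vertical (by norm_num)
  have hrc : ContinuousOn r (re ⁻¹' Ioo (-1 / 2) (3 / 2)) := by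
    rw [hr]; exact (differentiableOn_weight hx t).continuousOn
  have hr1 : Continuous fun y : ℝ ↦ r (((5 / 4 : ℝ) : ℂ) + y * I) := by
    refine hrc.comp_continuous (by fun_prop) fun y ↦ ?_
    simp only [mem_preimage, mem_Ioo, add_re, ofReal_re, mul_re, I_re, I_im, ofReal_im]
    norm_num
  have hr2 : Continuous fun y : ℝ ↦ r (1 - (((5 / 4 : ℝ) : ℂ) + y * I)) := by
    refine hrc.comp_continuous (by fun_prop) fun y ↦ ?_
    simp only [mem_preimage, mem_Ioo, sub_re, one_re, add_re, ofReal_re, mul_re, I_re, I_im,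
      ofReal_im]
    norm_num
  have i1 : IntervalIntegrable (fun y : ℝ ↦ logDeriv riemannXi (((5 / 4 : ℝ) : ℂ) + y * I) *
      r (((5 / 4 : ℝ) : ℂ) + y * I)) volume (-T) T :=
    (hc1.mul hr1).intervalIntegrable _ _
  have i2 : IntervalIntegrable (fun y : ℝ ↦ logDeriv riemannXi (((5 / 4 : ℝ) : ℂ) + y * I) *
      r (1 - (((5 / 4 : ℝ) : ℂ) + y * I))) volume (-T) T :=
    (hc1.mul hr2).intervalIntegrable _ _
  have hk : (∫ y : ℝ in (-T)..T, logDeriv riemannXi (((5 / 4 : ℝ) : ℂ) + y * I) *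
      (r (((5 / 4 : ℝ) : ℂ) + y * I) + r (1 - (((5 / 4 : ℝ) : ℂ) + y * I)))) =
      (∫ y : ℝ in (-T)..T, logDeriv riemannXi (((5 / 4 : ℝ) : ℂ) + y * I) *
        r (((5 / 4 : ℝ) : ℂ) + y * I)) +
      ∫ y : ℝ in (-T)..T, logDeriv riemannXi (((5 / 4 : ℝ) : ℂ) + y * I) *
        r (1 - (((5 / 4 : ℝ) : ℂ) + y * I)) := by
    rw [← intervalIntegral.integral_add i1 i2]
    congr 1 with y
    ring
  rw [hk]
  push_cast
  ring

/-! ## The zero side under RH -/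

/-- `1/(1+iu) − 1/(−1+iu) = 2/(1+u²)` for real `u`. [folklore] -/
theorem inv_sub_inv_eq_two_div (u : ℝ) :
    1 / (1 + (u : ℂ) * I) - 1 / (-1 + (u : ℂ) * I) = 2 / ((1 + u ^ 2 : ℝ) : ℂ) := by
  have h1 : (1 + (u : ℂ) * I) ≠ 0 := by
    intro h; have := congrArg re h; simp at this
  have h2 : (-1 + (u : ℂ) * I) ≠ 0 := by
    intro h; have := congrArg re h; simp at this
  have h3 : ((1 + u ^ 2 : ℝ) : ℂ) ≠ 0 := by
    exact_mod_cast (by positivity : (1 + u ^ 2 : ℝ) ≠ 0)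
  rw [div_sub_div _ _ h1 h2, div_eq_div_iff (mul_ne_zero h1 h2) h3]
  push_cast
  linear_combination (-2 * (u : ℂ) ^ 2) * I_mul_I

/-- **The weight at a pair of critical zeros**: for `x > 0` and real `t`, `γ`,
`r(1/2 + iγ) + r(1/2 − iγ) = 2x^{1/2} ( x^{iγ}/(1+(t−γ)²) + x^{−iγ}/(1+(t+γ)²) )`, i.e. the
`n`-th term of `2x^{1/2}·montgomeryZeroSum x t` at `γ = γ_n`. [cite: Goldston2005, Proposition 1 (3.11)] -/
theorem weight_half_add_weight_half_neg {x : ℝ} (hx : 0 < x) (t γ : ℝ) :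
    (x : ℂ) ^ ((1 / 2 : ℂ) + γ * I) *
        (1 / (((1 / 2 : ℂ) + γ * I) - (-1 / 2 + t * I)) - 1 / (((1 / 2 : ℂ) + γ * I) - (3 / 2 + t * I))) +
      (x : ℂ) ^ ((1 / 2 : ℂ) - γ * I) *
        (1 / (((1 / 2 : ℂ) - γ * I) - (-1 / 2 + t * I)) - 1 / (((1 / 2 : ℂ) - γ * I) - (3 / 2 + t * I))) =
      2 * (x : ℂ) ^ (1 / 2 : ℂ) *
        ((x : ℂ) ^ ((γ : ℂ) * I) / ((1 + (t - γ) ^ 2 : ℝ) : ℂ) +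
          (x : ℂ) ^ (-((γ : ℂ) * I)) / ((1 + (t + γ) ^ 2 : ℝ) : ℂ)) := by
  have hx0 : (x : ℂ) ≠ 0 := ofReal_ne_zero.2 hx.ne'
  have e1 : ((1 / 2 : ℂ) + γ * I) - (-1 / 2 + t * I) = 1 + ((γ - t : ℝ) : ℂ) * I := by
    push_cast; ring
  have e2 : ((1 / 2 : ℂ) + γ * I) - (3 / 2 + t * I) = -1 + ((γ - t : ℝ) : ℂ) * I := by
    push_cast; ring
  have e3 : ((1 / 2 : ℂ) - γ * I) - (-1 / 2 + t * I) = 1 + ((-γ - t : ℝ) : ℂ) * I := by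
    push_cast; ring
  have e4 : ((1 / 2 : ℂ) - γ * I) - (3 / 2 + t * I) = -1 + ((-γ - t : ℝ) : ℂ) * I := by
    push_cast; ring
  have e5 : ((1 + (γ - t) ^ 2 : ℝ) : ℂ) = ((1 + (t - γ) ^ 2 : ℝ) : ℂ) := by
    congr 1; ring
  have e6 : ((1 + (-γ - t) ^ 2 : ℝ) : ℂ) = ((1 + (t + γ) ^ 2 : ℝ) : ℂ) := by
    congr 1; ring
  have e7 : (x : ℂ) ^ ((1 / 2 : ℂ) + γ * I) = (x : ℂ) ^ (1 / 2 : ℂ) * (x : ℂ) ^ ((γ : ℂ) * I) := by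
    rw [cpow_add _ _ hx0]
  have e8 : (x : ℂ) ^ ((1 / 2 : ℂ) - γ * I) = (x : ℂ) ^ (1 / 2 : ℂ) * (x : ℂ) ^ (-((γ : ℂ) * I)) := by
    rw [sub_eq_add_neg, cpow_add _ _ hx0]
  rw [e1, e2, e3, e4, inv_sub_inv_eq_two_div, inv_sub_inv_eq_two_div, e5, e6, e7, e8]
  ring

/-- Under RH the zeros of the box `zetaZeroBox 0 T` lie on the critical line. [folklore] -/
theorem re_eq_half_of_mem_zetaZeroBox (hRH : RiemannHypothesis) {T : ℝ} {ρ : ℂ}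
    (hρ : ρ ∈ zetaZeroBox 0 T) : ρ.re = 1 / 2 := by
  obtain ⟨hζ, -, -, him, -⟩ := hρ
  refine hRH ρ hζ ?_ ?_
  · rintro ⟨n, hn⟩
    have := congrArg im hn
    simp at this
    linarith
  · intro h
    rw [h] at him
    simp at him

/-- **The truncated zero side under RH.** For `x > 0` and real `t`, `T`:
`Σ_{ρ ∈ weilZeroIndex T} m(ρ) r(ρ) = 2x^{1/2} Σ_{n < N(T)} (x^{iγ_n}/(1+(t−γ_n)²) + x^{−iγ_n}/(1+(t+γ_n)²))`
(`weilZeroIndex T = box ∪ conj box`, `m(ρ̄) = m(ρ)`, `ρ = 1/2 + iγ` by RH, and the enumeration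
`finsum_zetaZeroBox_mul_eq_sum_range`). [cite: Goldston2005, Proposition 1 (3.11)] -/
theorem zeroSidePartial_eq_sum_range (hRH : RiemannHypothesis) {x : ℝ} (hx : 0 < x) (t T : ℝ) :
    ∑ᶠ ρ ∈ weilZeroIndex T, (riemannZetaZeroOrder ρ : ℂ) *
        ((x : ℂ) ^ ρ * (1 / (ρ - (-1 / 2 + t * I)) - 1 / (ρ - (3 / 2 + t * I)))) =
      2 * (x : ℂ) ^ (1 / 2 : ℂ) *
        ∑ n ∈ Finset.range (zetaZeroCount T), montgomeryZeroSummand x t n := by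
  obtain ⟨r, hr⟩ : ∃ r : ℂ → ℂ, r = fun s : ℂ ↦ (x : ℂ) ^ s *
      (1 / (s - (-1 / 2 + t * I)) - 1 / (s - (3 / 2 + t * I))) := ⟨_, rfl⟩
  have er : ∀ s : ℂ, (x : ℂ) ^ s * (1 / (s - (-1 / 2 + t * I)) - 1 / (s - (3 / 2 + t * I))) = r s := by
    intro s; rw [hr]
  simp only [er]
  -- the two halves of the index set
  have hfin := zetaZeroBox_finite 0 T
  have hdisj : Disjoint (zetaZeroBox 0 T) ((starRingEnd ℂ) '' zetaZeroBox 0 T) := by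
    refine Set.disjoint_left.2 fun ρ h1 h2 ↦ ?_
    obtain ⟨w, hw, rfl⟩ := h2
    have h1' : 0 < (conj w).im := h1.2.2.2.1
    have h2' : 0 < w.im := hw.2.2.2.1
    rw [conj_im] at h1'
    linarith
  have hinj : (zetaZeroBox 0 T).InjOn (starRingEnd ℂ) := fun a _ b _ h ↦ by
    simpa using congrArg conj h
  rw [weilZeroIndex_eq_union, finsum_mem_union hdisj hfin (hfin.image _), finsum_mem_image hinj]
  -- RH: `ρ = 1/2 + iγ`, `ρ̄ = 1/2 − iγ`, `m(ρ̄) = m(ρ)`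
  have hA : ∑ᶠ ρ ∈ zetaZeroBox 0 T, (riemannZetaZeroOrder ρ : ℂ) * r ρ =
      ∑ᶠ ρ ∈ zetaZeroBox 0 T, (riemannZetaZeroOrder ρ : ℂ) *
        (fun γ : ℝ ↦ r ((1 / 2 : ℂ) + γ * I)) ρ.im := by
    refine finsum_mem_congr rfl fun ρ hρ ↦ ?_
    have hre := re_eq_half_of_mem_zetaZeroBox hRH hρ
    have h : ρ = (1 / 2 : ℂ) + (ρ.im : ℂ) * I := by
      apply Complex.ext <;> simp [hre]
    simp only
    rw [← h]
  have hB : ∑ᶠ ρ ∈ zetaZeroBox 0 T, (riemannZetaZeroOrder ((starRingEnd ℂ) ρ) : ℂ) *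
      r ((starRingEnd ℂ) ρ) =
      ∑ᶠ ρ ∈ zetaZeroBox 0 T, (riemannZetaZeroOrder ρ : ℂ) *
        (fun γ : ℝ ↦ r ((1 / 2 : ℂ) - γ * I)) ρ.im := by
    refine finsum_mem_congr rfl fun ρ hρ ↦ ?_
    simp only
    rw [riemannZetaZeroOrder_conj_holds ρ]
    congr 2
    have hre := re_eq_half_of_mem_zetaZeroBox hRH hρ
    apply Complex.ext <;> simp [hre]
  rw [hA, hB, finsum_zetaZeroBox_mul_eq_sum_range (fun γ : ℝ ↦ r ((1 / 2 : ℂ) + γ * I)) T,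
    finsum_zetaZeroBox_mul_eq_sum_range (fun γ : ℝ ↦ r ((1 / 2 : ℂ) - γ * I)) T,
    ← Finset.sum_add_distrib, Finset.mul_sum]
  refine Finset.sum_congr rfl fun n _ ↦ ?_
  simp only [hr, montgomeryZeroSummand]
  exact weight_half_add_weight_half_neg hx t (zetaOrdinate n)

/-! ## The horizontal sides -/

/-- The weight on the horizontal sides: for `x ≥ 1`, `σ ∈ [−1/4, 5/4]` and `|τ| ≥ |t| + 1`,
`‖r(σ + iτ)‖ ≤ 2x^{5/4}/(|τ| − |t|)`. [folklore] -/
theorem norm_weight_horizontal_le {x : ℝ} (hx : 1 ≤ x) (t : ℝ) {σ τ : ℝ}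
    (hσ : σ ∈ Icc (-(1 / 4) : ℝ) (5 / 4)) (hτ : |t| + 1 ≤ |τ|) :
    ‖(x : ℂ) ^ ((σ : ℂ) + τ * I) *
        (1 / ((σ : ℂ) + τ * I - (-1 / 2 + t * I)) - 1 / ((σ : ℂ) + τ * I - (3 / 2 + t * I)))‖ ≤
      2 * x ^ (5 / 4 : ℝ) / (|τ| - |t|) := by
  have hx0 : 0 < x := one_pos.trans_le hx
  have hd : 0 < |τ| - |t| := by linarith
  rw [norm_mul]
  have h1 : ‖(x : ℂ) ^ ((σ : ℂ) + τ * I)‖ ≤ x ^ (5 / 4 : ℝ) := by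
    rw [norm_cpow_eq_rpow_re_of_pos hx0]
    simp only [add_re, ofReal_re, mul_re, I_re, mul_zero, ofReal_im, I_im, mul_one, sub_self,
      add_zero]
    exact Real.rpow_le_rpow_of_exponent_le hx hσ.2
  have hk : ∀ d : ℂ, d.im = t → ‖1 / ((σ : ℂ) + τ * I - d)‖ ≤ 1 / (|τ| - |t|) := by
    intro d hd'
    rw [norm_div, norm_one]
    apply one_div_le_one_div_of_le hd
    have h := abs_im_le_norm ((σ : ℂ) + τ * I - d)
    have him : ((σ : ℂ) + τ * I - d).im = τ - t := by simp [hd']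
    rw [him] at h
    have h2 : |τ| - |t| ≤ |τ - t| := abs_sub_abs_le_abs_sub τ t
    linarith
  have h2 : ‖1 / ((σ : ℂ) + τ * I - (-1 / 2 + t * I)) - 1 / ((σ : ℂ) + τ * I - (3 / 2 + t * I))‖ ≤
      2 / (|τ| - |t|) := by
    refine (norm_sub_le _ _).trans ?_
    have ha := hk (-1 / 2 + t * I) (by simp)
    have hb := hk (3 / 2 + t * I) (by simp)
    have : (2 : ℝ) / (|τ| - |t|) = 1 / (|τ| - |t|) + 1 / (|τ| - |t|) := by ring
    linarith
  calc ‖(x : ℂ) ^ ((σ : ℂ) + τ * I)‖ *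
        ‖1 / ((σ : ℂ) + τ * I - (-1 / 2 + t * I)) - 1 / ((σ : ℂ) + τ * I - (3 / 2 + t * I))‖
      ≤ x ^ (5 / 4 : ℝ) * (2 / (|τ| - |t|)) := mul_le_mul h1 h2 (norm_nonneg _) (by positivity)
    _ = 2 * x ^ (5 / 4 : ℝ) / (|τ| - |t|) := by ring

/-- **The horizontal sides at a good height**: for `x ≥ 1`, `T ≥ 2`, `T ≥ |t| + 1`, `0 < η ≤ 1`
with all zeros of positive real part `η`-away from the ordinate `T`, and `τ = ±T`,
`‖∫_{−1/4}^{5/4} (ξ'/ξ)(σ+iτ) r(σ+iτ) dσ‖ ≤ (3/2)·(C log(T+4)/η)·(2x^{5/4}/(T − |t|))`, `C` the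
constant of `exists_norm_logDeriv_riemannXi_le`. [folklore] -/
theorem norm_horizontal_le {x : ℝ} (hx : 1 ≤ x) (t : ℝ) {C : ℝ}
    (hC : ∀ (τ η : ℝ), 2 ≤ |τ| → 0 < η → η ≤ 1 →
      (∀ ρ : ℂ, riemannZeta ρ = 0 → 0 < ρ.re → η ≤ |ρ.im - τ|) →
      ∀ σ : ℝ, σ ∈ Icc (-(1 / 2) : ℝ) (3 / 2) →
        ‖logDeriv riemannXi (σ + τ * I)‖ ≤ C * Real.log (|τ| + 4) / η)
    {T η : ℝ} (hT : 2 ≤ T) (htT : |t| + 1 ≤ T) (hη : 0 < η) (hη1 : η ≤ 1)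
    (hZ : ∀ ρ : ℂ, riemannZeta ρ = 0 → 0 < ρ.re → η ≤ |ρ.im - T|) {τ : ℝ} (hτ : τ = T ∨ τ = -T) :
    ‖∫ σ : ℝ in (-(1 / 4) : ℝ)..(5 / 4), logDeriv riemannXi (σ + τ * I) *
        ((x : ℂ) ^ ((σ : ℂ) + τ * I) *
          (1 / ((σ : ℂ) + τ * I - (-1 / 2 + t * I)) - 1 / ((σ : ℂ) + τ * I - (3 / 2 + t * I))))‖ ≤
      (3 / 2) * ((C * Real.log (T + 4) / η) * (2 * x ^ (5 / 4 : ℝ) / (T - |t|))) := by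
  have hTabs : |T| = T := abs_of_pos (by linarith)
  have hτabs : |τ| = T := by
    rcases hτ with rfl | rfl
    · exact hTabs
    · rw [abs_neg, hTabs]
  have hpt : ∀ σ ∈ Icc (-(1 / 4) : ℝ) (5 / 4), ‖logDeriv riemannXi (σ + τ * I) *
      ((x : ℂ) ^ ((σ : ℂ) + τ * I) *
        (1 / ((σ : ℂ) + τ * I - (-1 / 2 + t * I)) - 1 / ((σ : ℂ) + τ * I - (3 / 2 + t * I))))‖ ≤
      (C * Real.log (T + 4) / η) * (2 * x ^ (5 / 4 : ℝ) / (T - |t|)) := by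
    intro σ hσ
    rw [norm_mul]
    have hσ' : σ ∈ Icc (-(1 / 2) : ℝ) (3 / 2) := ⟨by linarith [hσ.1], by linarith [hσ.2]⟩
    have h1 : ‖logDeriv riemannXi (σ + τ * I)‖ ≤ C * Real.log (T + 4) / η := by
      rcases hτ with rfl | rfl
      · have := hC τ η (by rw [hTabs]; exact hT) hη hη1 hZ σ hσ'
        rwa [hTabs] at this
      · have e : (σ : ℂ) + ((-T : ℝ) : ℂ) * I = conj ((σ : ℂ) + T * I) := by
          apply Complex.ext <;> simp
        rw [e, logDeriv_riemannXi_conj, Complex.norm_conj]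
        have := hC T η (by rw [hTabs]; exact hT) hη hη1 hZ σ hσ'
        rwa [hTabs] at this
    have h2 := norm_weight_horizontal_le hx t hσ (τ := τ) (by rw [hτabs]; linarith)
    rw [hτabs] at h2
    have h0 : 0 ≤ C * Real.log (T + 4) / η := le_trans (norm_nonneg _) h1
    exact mul_le_mul h1 h2 (norm_nonneg _) h0
  have h := intervalIntegral.norm_integral_le_of_norm_le_const (a := (-(1 / 4) : ℝ)) (b := 5 / 4)
    (f := fun σ : ℝ ↦ logDeriv riemannXi (σ + τ * I) *
      ((x : ℂ) ^ ((σ : ℂ) + τ * I) *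
        (1 / ((σ : ℂ) + τ * I - (-1 / 2 + t * I)) - 1 / ((σ : ℂ) + τ * I - (3 / 2 + t * I)))))
    (C := (C * Real.log (T + 4) / η) * (2 * x ^ (5 / 4 : ℝ) / (T - |t|))) fun σ hσ ↦ by
      rw [uIoc_of_le (by norm_num)] at hσ
      exact hpt σ ⟨hσ.1.le, hσ.2⟩
  refine h.trans (le_of_eq ?_)
  rw [show |(5 : ℝ) / 4 - -(1 / 4)| = 3 / 2 by norm_num]
  ring

/-- Bookkeeping for the horizontal sides: for `C, X ≥ 0`, `c₀ > 0`, `T ≥ 2`, `2a ≤ T`,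
`(3/2)·(C log(T+4)/min(c₀/log(|T|+2), 1))·(2X/(T−a)) ≤ 18 C (1/c₀ + 1) X · log(T+4)²/(T+4)`.
[folklore] -/
theorem horizontal_bound_aux {C c₀ X T a : ℝ} (hC : 0 ≤ C) (hc₀ : 0 < c₀) (hX : 0 ≤ X)
    (hT : 2 ≤ T) (haT : 2 * a ≤ T) :
    (3 / 2) * ((C * Real.log (T + 4) / min (c₀ / Real.log (|T| + 2)) 1) * (2 * X / (T - a))) ≤
      18 * C * (1 / c₀ + 1) * X * (Real.log (T + 4) ^ 2 / (T + 4)) := by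
  have hTabs : |T| = T := abs_of_pos (by linarith)
  rw [hTabs]
  set L : ℝ := Real.log (T + 4) with hL
  have hL1 : 1 ≤ L := by
    rw [hL, Real.le_log_iff_exp_le (by linarith)]
    linarith [Real.exp_one_lt_three]
  have hL0 : 0 ≤ L := by linarith
  have hlog2 : 0 < Real.log (T + 2) := Real.log_pos (by linarith)
  have hlog24 : Real.log (T + 2) ≤ L := Real.log_le_log (by linarith) (by linarith)
  set u : ℝ := c₀ / Real.log (T + 2) with hu
  have hu0 : 0 < u := div_pos hc₀ hlog2
  -- `1/min(u,1) ≤ (1/c₀ + 1) L`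
  have hm0 : 0 < min u 1 := lt_min hu0 one_pos
  have hinv : 1 / min u 1 ≤ (1 / c₀ + 1) * L := by
    have h1u : 1 / u ≤ L / c₀ := by
      rw [hu, one_div_div]
      exact div_le_div_of_nonneg_right hlog24 hc₀.le
    have key : 1 / min u 1 ≤ 1 / u + 1 := by
      rcases le_total u 1 with h | h
      · rw [min_eq_left h]; linarith [one_div_pos.2 hu0]
      · rw [min_eq_right h, div_one]
        have : 0 < 1 / u := one_div_pos.2 hu0
        linarith
    calc 1 / min u 1 ≤ 1 / u + 1 := key
      _ ≤ L / c₀ + L := by linarith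
      _ = (1 / c₀ + 1) * L := by ring
  have h1 : C * L / min u 1 ≤ C * (1 / c₀ + 1) * L ^ 2 := by
    rw [div_eq_mul_one_div]
    calc C * L * (1 / min u 1) ≤ C * L * ((1 / c₀ + 1) * L) := by
          exact mul_le_mul_of_nonneg_left hinv (by positivity)
      _ = C * (1 / c₀ + 1) * L ^ 2 := by ring
  have h2 : 2 * X / (T - a) ≤ 12 * X / (T + 4) := by
    rw [div_le_div_iff₀ (by linarith) (by linarith)]
    nlinarith
  have h0 : 0 ≤ 2 * X / (T - a) := div_nonneg (by positivity) (by linarith)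
  calc (3 / 2) * ((C * L / min u 1) * (2 * X / (T - a)))
      ≤ (3 / 2) * ((C * (1 / c₀ + 1) * L ^ 2) * (12 * X / (T + 4))) := by
        exact mul_le_mul_of_nonneg_left (mul_le_mul h1 h2 h0 (by positivity)) (by norm_num)
    _ = 18 * C * (1 / c₀ + 1) * X * (L ^ 2 / (T + 4)) := by ring

/-! ## The explicit formula as an identity of the zero sum with the line integral -/

/-- **`2π · 2x^{1/2} S(x,t) = ∫ (ξ'/ξ)(s)[r(s) + r(1−s)] dy` on `re s = 5/4`** (RH; `x ≥ 1`, real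
`t`): the contour identity `zeroSidePartial_eq_contour` at the good heights of
`ZetaLogDerivRH.exists_goodHeight` (under RH every zero of positive real part is `≫ 1/log T` away
from them), the horizontal sides tending to `0` (`ξ'/ξ ≪ log²T` there, `r ≪ x^{5/4}/T`), the right
edge tending to the absolutely convergent line integral, and the truncated zero sums tending to
`2x^{1/2} S(x,t)` (`zeroSidePartial_eq_sum_range`, `N(T) → ∞`, absolute convergence of `S`).
[cite: Goldston2005, Proposition 1, (3.13)–(3.14)] -/
theorem two_pi_mul_zeroSum_eq_lineIntegral (hRH : RiemannHypothesis) {x : ℝ} (hx : 1 ≤ x)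
    (t : ℝ) :
    2 * π * (2 * (x : ℂ) ^ (1 / 2 : ℂ) * montgomeryZeroSum x t) =
      ∫ y : ℝ, logDeriv riemannXi (((5 / 4 : ℝ) : ℂ) + y * I) *
        ((x : ℂ) ^ (((5 / 4 : ℝ) : ℂ) + y * I) *
            (1 / (((5 / 4 : ℝ) : ℂ) + y * I - (-1 / 2 + t * I)) -
              1 / (((5 / 4 : ℝ) : ℂ) + y * I - (3 / 2 + t * I))) +
          (x : ℂ) ^ (1 - ((((5 / 4 : ℝ) : ℂ)) + y * I)) *
            (1 / ((1 - ((((5 / 4 : ℝ) : ℂ)) + y * I)) - (-1 / 2 + t * I)) -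
              1 / ((1 - ((((5 / 4 : ℝ) : ℂ)) + y * I)) - (3 / 2 + t * I)))) := by
  have hx0 : 0 < x := one_pos.trans_le hx
  -- the integrand on the right edge is integrable
  have hint := integrable_logDeriv_riemannXi_mul_kernels hx t (c := 5 / 4) (by norm_num) (by norm_num)
  -- the weight
  obtain ⟨r, hr⟩ : ∃ r : ℂ → ℂ, r = fun s : ℂ ↦ (x : ℂ) ^ s *
      (1 / (s - (-1 / 2 + t * I)) - 1 / (s - (3 / 2 + t * I))) := ⟨_, rfl⟩
  have er : ∀ s : ℂ, (x : ℂ) ^ s * (1 / (s - (-1 / 2 + t * I)) - 1 / (s - (3 / 2 + t * I))) = r s := by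
    intro s; rw [hr]
  simp only [er] at hint ⊢
  set Z : ℂ := 2 * (x : ℂ) ^ (1 / 2 : ℂ) * montgomeryZeroSum x t with hZdef
  -- good heights
  obtain ⟨c₀, hc₀, hgh⟩ := ZetaLogDerivRH.exists_goodHeight
  choose T hT hTZ using fun N : ℕ ↦ hgh (N : ℝ)
  have hT1 : ∀ N : ℕ, (N : ℝ) ≤ T N := fun N ↦ (hT N).1
  have hTtop : Tendsto T atTop atTop := tendsto_atTop_mono hT1 tendsto_natCast_atTop_atTop
  -- RH: every zero of positive real part lies in `zetaZerosRight`
  have hright : ∀ ρ : ℂ, riemannZeta ρ = 0 → 0 < ρ.re → ρ ∈ zetaZerosRight := by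
    intro ρ hζ h0
    refine ⟨hζ, ?_⟩
    have : ρ.re = 1 / 2 := by
      refine hRH ρ hζ ?_ ?_
      · rintro ⟨n, hn⟩
        rw [hn] at h0
        simp at h0
        linarith
      · intro h
        rw [h] at hζ
        exact riemannZeta_one_ne_zero hζ
    rw [this]; norm_num
  -- the distances `η N`
  set η : ℕ → ℝ := fun N ↦ min (c₀ / Real.log (|T N| + 2)) 1 with hη
  have hη0 : ∀ N, 0 < η N := fun N ↦
    lt_min (div_pos hc₀ (Real.log_pos (by linarith [abs_nonneg (T N)]))) one_pos
  have hη1 : ∀ N, η N ≤ 1 := fun N ↦ min_le_right _ _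
  have hηZ : ∀ N, ∀ ρ : ℂ, riemannZeta ρ = 0 → 0 < ρ.re → η N ≤ |ρ.im - T N| :=
    fun N ρ hζ h0 ↦ (min_le_left _ _).trans (hTZ N ρ (hright ρ hζ h0))
  have hgood : ∀ N, ∀ ρ ∈ ZetaZeros.riemannZetaNontrivialZeros, ρ.im ≠ T N ∧ ρ.im ≠ -T N :=
    fun N ρ hρ ↦ im_ne_of_good (hη0 N) (fun ρ' hρ' ↦ hηZ N ρ'
      (ZetaZeros.riemannZetaNontrivialZeros.zeta_eq_zero hρ')
      (ZetaZeros.riemannZetaNontrivialZeros.re_pos hρ')) hρ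
  -- the pieces of the contour
  set bot : ℕ → ℂ := fun N ↦ ∫ σ : ℝ in (-(1 / 4) : ℝ)..(5 / 4),
    logDeriv riemannXi (σ + (-T N : ℝ) * I) * r (σ + (-T N : ℝ) * I) with hbot
  set top : ℕ → ℂ := fun N ↦ ∫ σ : ℝ in (-(1 / 4) : ℝ)..(5 / 4),
    logDeriv riemannXi (σ + T N * I) * r (σ + T N * I) with htop
  set V : ℕ → ℂ := fun N ↦ ∫ y : ℝ in (-T N)..T N, logDeriv riemannXi (((5 / 4 : ℝ) : ℂ) + y * I) *
    (r (((5 / 4 : ℝ) : ℂ) + y * I) + r (1 - (((5 / 4 : ℝ) : ℂ) + y * I))) with hV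
  set Vinf : ℂ := ∫ y : ℝ, logDeriv riemannXi (((5 / 4 : ℝ) : ℂ) + y * I) *
    (r (((5 / 4 : ℝ) : ℂ) + y * I) + r (1 - (((5 / 4 : ℝ) : ℂ) + y * I))) with hVinf
  set S : ℕ → ℂ := fun N ↦ 2 * (x : ℂ) ^ (1 / 2 : ℂ) *
    ∑ n ∈ Finset.range (zetaZeroCount (T N)), montgomeryZeroSummand x t n with hS
  -- the contour identity along the good heights
  have hident : ∀ N : ℕ, 1 ≤ N → S N = (bot N - top N + I * V N) / (2 * π * I) := by
    intro N hN
    have hN' : (1 : ℝ) ≤ N := by exact_mod_cast hN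
    have hTpos : 0 < T N := by linarith [hT1 N]
    have h := zeroSidePartial_eq_contour hx0 t hTpos (hgood N)
    have h' := zeroSidePartial_eq_sum_range hRH hx0 t (T N)
    simp only [er] at h h'
    rw [h'] at h
    have h2πI : (2 * π * I : ℂ) ≠ 0 := by simp [Real.pi_ne_zero, I_ne_zero]
    rw [eq_div_iff h2πI, mul_comm, h]
  -- the horizontal sides tend to `0`
  obtain ⟨C, hC0, hC⟩ := exists_norm_logDeriv_riemannXi_le
  have hg : Tendsto (fun N : ℕ ↦ 18 * C * (1 / c₀ + 1) * x ^ (5 / 4 : ℝ) *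
      (Real.log (T N + 4) ^ 2 / (T N + 4))) atTop (𝓝 0) := by
    have h1 : Tendsto (fun u : ℝ ↦ Real.log u ^ 2 / u) atTop (𝓝 0) := by
      have := (Real.isLittleO_pow_log_id_atTop (n := 2)).tendsto_div_nhds_zero
      simpa using this
    have h2 : Tendsto (fun N : ℕ ↦ T N + 4) atTop atTop := tendsto_atTop_add_const_right _ _ hTtop
    have h3 := h1.comp h2
    rw [show (0 : ℝ) = 18 * C * (1 / c₀ + 1) * x ^ (5 / 4 : ℝ) * 0 by ring]
    exact h3.const_mul _
  have hedge : ∀ e : ℝ, (e = 1 ∨ e = -1) → Tendsto (fun N : ℕ ↦ ∫ σ : ℝ in (-(1 / 4) : ℝ)..(5 / 4),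
      logDeriv riemannXi (σ + (e * T N : ℝ) * I) * r (σ + (e * T N : ℝ) * I)) atTop (𝓝 0) := by
    intro e he
    rw [tendsto_zero_iff_norm_tendsto_zero]
    refine squeeze_zero' (Eventually.of_forall fun _ ↦ norm_nonneg _)
      ((eventually_ge_atTop (⌈2 * |t|⌉₊ + 2)).mono fun N hN ↦ ?_) hg
    have hN' : (⌈2 * |t|⌉₊ : ℝ) + 2 ≤ N := by exact_mod_cast hN
    have hceil : 2 * |t| ≤ ⌈2 * |t|⌉₊ := Nat.le_ceil _
    have hTN2 : 2 ≤ T N := by linarith [hT1 N, abs_nonneg t]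
    have hTNt : |t| + 1 ≤ T N := by linarith [hT1 N, abs_nonneg t]
    have hTN2t : 2 * |t| ≤ T N := by linarith [hT1 N]
    have het : e * T N = T N ∨ e * T N = -T N := by
      rcases he with rfl | rfl
      · exact Or.inl (one_mul _)
      · exact Or.inr (neg_one_mul _)
    have hb := norm_horizontal_le hx t hC hTN2 hTNt (hη0 N) (hη1 N) (hηZ N) het
    simp only [er] at hb
    exact hb.trans (horizontal_bound_aux hC0.le hc₀ (by positivity) hTN2 hTN2t)
  have hbot_lim : Tendsto bot atTop (𝓝 0) := by
    refine (hedge (-1) (Or.inr rfl)).congr fun N ↦ ?_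
    simp [hbot]
  have htop_lim : Tendsto top atTop (𝓝 0) := by
    refine (hedge 1 (Or.inl rfl)).congr fun N ↦ ?_
    simp [htop]
  -- the right edge tends to the line integral
  have hV_lim : Tendsto V atTop (𝓝 Vinf) :=
    intervalIntegral_tendsto_integral hint (tendsto_neg_atTop_atBot.comp hTtop) hTtop
  have hrhs : Tendsto (fun N ↦ (bot N - top N + I * V N) / (2 * π * I)) atTop
      (𝓝 ((0 - 0 + I * Vinf) / (2 * π * I))) :=
    ((hbot_lim.sub htop_lim).add (hV_lim.const_mul I)).div_const _
  -- the zero side tends to `Z`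
  have hS_lim : Tendsto S atTop (𝓝 Z) := by
    have h1 := (summable_montgomeryZeroSummand hx0 t).hasSum.tendsto_sum_nat
    have h2 : Tendsto (fun N : ℕ ↦ zetaZeroCount (T N)) atTop atTop :=
      tendsto_zetaZeroCount_atTop_holds.comp hTtop
    have h3 := (h1.comp h2).const_mul (2 * (x : ℂ) ^ (1 / 2 : ℂ))
    refine h3.congr fun N ↦ ?_
    simp [hS]
  have hS' : Tendsto S atTop (𝓝 ((0 - 0 + I * Vinf) / (2 * π * I))) :=
    hrhs.congr' ((eventually_ge_atTop 1).mono fun N hN ↦ (hident N hN).symm)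
  have hlim := tendsto_nhds_unique hS_lim hS'
  rw [hlim]
  have h2πI : (2 * π * I : ℂ) ≠ 0 := by simp [Real.pi_ne_zero, I_ne_zero]
  field_simp
  ring

end Montgomery

end Literature.NumberTheory.LFunctions
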